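import Summits.AnomalousDissipation.AnomalousDissipation.Theorems.BaireTransferRobustLoudUpgradeLineScalingDefs
import Summits.AnomalousDissipation.AnomalousDissipation.Theorems.BaireTransferRobustLoudUpgradeStubUnfoldingPersist
import Summits.AnomalousDissipation.AnomalousDissipation.Theorems.BaireTransferRobustLoudUpgradeStubSteadyWindowNear
import Summits.AnomalousDissipation.AnomalousDissipation.Theorems.BaireTransferRobustLoudUpgradeStubRadialIsUnfolding

/-!
# Line `malkin-cone-group-orbits`, companion c5 ("THE INTRINSIC UNFOLDING, SOLVED NOT SWEPT"): the near-persistent and the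
# intrinsically visible steady classes, the tame union `tameUnfold`, and the line glue
# (crux `BaireTransfer.RobustLoudUpgrade`, stmt-AnomalousDissipation-1144)

Definitions + glue (reviewed for the four definitions).  A classical steady witness `u₀` of `f_c` at viscosity `ν` carries FOUR
unfolding parameters that are free in `LOUD` and enter the steady problem as honest unknowns: the viscosity (`∃ ν < a`) and the
conserved spatial mean `m = ⨍u₀ ∈ ℝ³` (Galilean drift: `IsClassicalNSSolutionOn` imposes no mean condition and the mean is
conserved; drifted steady system `−νΔv + (m·∇)v + (v·∇)v + ∇p = f`, `u = m + v`, Literature `SteadyNSLatticePersistenceDrift`).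
Their infinitesimal generators in the range of the steady map are `Δu₀` and `∂ᵢu₀`.

* `SteadyPersistsNear` / `persistSteadyNear`: persistence of a classical steady state of ANY mean under change of the force, with
  the viscosity allowed to move (`|ν' − ν| < δ`) and the perturbed state `H¹`-close; TAME by the landed window
  `SteadyWindowNear.stub_steadyWindowNear` (p129964): budgets stay in the strict slack, so `persistSteadyNear ⊆ interior LOUD`.
* `unfoldSteady` (class U): a classical steady witness of any mean with strict budgets whose classical mean-zero kernel lies on one
  complex line `ℂ·v` and for which an INTRINSIC border `αΔu₀ + ∑ᵢ dirᵢ∂ᵢu₀` is first-order visible (`∉ range L(ν,u₀)`).  By the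
  landed `Unfolding.stub_unfoldingPersist` (p130983; the bordered implicit function theorem
  `Literature.Analysis.Calculus.bordered_unfolding_persistence` run on the drifted Fourier lattice in the unknowns (state, r) with
  viscosity `ν − rα` and mean `m + r·dir`) such a witness persists in the sense of `SteadyPersistsNear`: `unfoldSteady ⊆
  persistSteadyNear ⊆ interior LOUD` — no cone, no sign change, no scaling, every `S`, every mean.  The class contains c4's
  radially visible class R (`dir = 0`, `α = 1`; and extends it to every conserved-mean leaf) and the drift-visible simple
  degeneracies (`α = 0`), which no symmetry forbids (only the force-translation directions `∂ᵢf_c = −L(ν,u₀)∂ᵢu₀` are always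
  invisible).
* `tameUnfold := tameScaling ∪ persistSteadyNear ∪ unfoldSteady ⊆ closure (interior LOUD)`; `line_glue_c5` (registered): the residual
  over `tameUnfold` proves the crux BY NAME.

References: Temam 1979 Ch. II §1; Chow–Hale 1982 §2.4; Kielhöfer 2012 §I.2; the route file (item 1144);
`Cruxes/RobustLoudUpgrade/Lines/malkin_cone_group_orbits_c5.lean` (the checked skeleton of this companion);
`Cruxes/RobustLoudUpgrade/Disproof.lean` §9 (scaling covariance), §11 (phase invariance).
-/

-- `Summit.<Summit>.<Problem>` is the tree's mandated summit-side namespace (CONVENTIONS §2); for this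
-- single-conjunct summit the two coincide, so the duplicate is deliberate.
set_option linter.dupNamespace false

noncomputable section

open scoped BigOperators Topology
open Filter Set Function TopologicalSpace MeasureTheory

namespace Summit.AnomalousDissipation.AnomalousDissipation.Theorems.RobustLoudUpgrade

open Literature.Analysis.FunctionSpaces Literature.Analysis.FunctionSpaces.Torus
open Literature.Analysis.FluidPDE
open Summit.AnomalousDissipation.AnomalousDissipation.Theses.BaireTransfer

namespace Unfolding

/-! ## §1 The classes of the companion c5 -/

/-- **Persistence NEAR a steady state, viscosity and mean free**: for every `δ > 0` all forces `f_{c'}`, `c'` near `c`, carry a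
classical steady state `u'` of `NS_{ν'}` for some `ν'` with `|ν' − ν| < δ`, within squared `H¹`-distance `δ` of `u₀` (the
conclusion of `Unfolding.stub_unfoldingPersist`; compare `SteadyPersistsAt` (same `ν`, mean zero) and `SteadyPersistsInLeaf` (same
`ν`, same mean)). [folklore] -/
@[folklore] def SteadyPersistsNear (S : Finset (Fin 3 → ℤ)) (c : Coeff S) (ν : ℝ)
    (u₀ : UnitAddTorus (Fin 3) → EuclideanSpace ℝ (Fin 3)) : Prop :=
  ∀ δ : ℝ, 0 < δ → ∃ r : ℝ, 0 < r ∧ ∀ c' : Coeff S, dist c' c < r →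
    ∃ (ν' : ℝ) (u' : UnitAddTorus (Fin 3) → EuclideanSpace ℝ (Fin 3)) (p' : UnitAddTorus (Fin 3) → ℝ),
      |ν' - ν| < δ ∧ Torus.IsSteadyNSState ν' (force S c') u' p' ∧ h1DistSq u' u₀ < δ

/-- **Near-persistent loud steady witnesses** (any mean; viscosity free): a classical steady witness with strict budgets that
persists in the sense of `SteadyPersistsNear`. [folklore] -/
def persistSteadyNear (S : Finset (Fin 3 → ℤ)) (a E ε : ℝ) : Set (Coeff S) :=
  {c | ∃ ν : ℝ, 0 < ν ∧ ν < a ∧ ∃ (u₀ : UnitAddTorus (Fin 3) → EuclideanSpace ℝ (Fin 3)) (p₀ : UnitAddTorus (Fin 3) → ℝ),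
    Torus.IsSteadyNSState ν (force S c) u₀ p₀ ∧ meanEnergy (fun _ : ℝ => u₀) < E ∧
      ε < meanDissipation ν (fun _ : ℝ => u₀) ∧ SteadyPersistsNear S c ν u₀}

/-- **Intrinsically visible simply degenerate steady witnesses** (class U of the companion c5): a classical steady witness of ANY
mean with strict budgets, whose classical mean-zero kernel lies on one complex line `ℂ·v`, and for which an INTRINSIC border
`αΔu₀ + ∑ᵢ dirᵢ ∂ᵢu₀` — a generator of the viscosity (`Δu₀`) and Galilean-drift (`∂ᵢu₀`) unfoldings — is first-order visible,
`∉ range L(ν,u₀)`.  Contains c4's radially visible class (every leaf) and the drift-visible degeneracies. [folklore] -/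
def unfoldSteady (S : Finset (Fin 3 → ℤ)) (a E ε : ℝ) : Set (Coeff S) :=
  {c | ∃ ν : ℝ, 0 < ν ∧ ν < a ∧ ∃ (u₀ : UnitAddTorus (Fin 3) → EuclideanSpace ℝ (Fin 3)) (p₀ : UnitAddTorus (Fin 3) → ℝ),
    Torus.IsSteadyNSState ν (force S c) u₀ p₀ ∧ meanEnergy (fun _ : ℝ => u₀) < E ∧
      ε < meanDissipation ν (fun _ : ℝ => u₀) ∧
      ∃ v : UnitAddTorus (Fin 3) → EuclideanSpace ℝ (Fin 3), IsSmooth v ∧ IsDivFree v ∧ HasZeroMean v ∧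
        (∀ w, Torus.LinNSResolventRel ν u₀ 0 w 0 → ∃ z : ℂ, w = z • cplx v) ∧
        ∃ (α : ℝ) (dir : Fin 3 → ℤ),
          ∀ w, ¬ Torus.LinNSResolventRel ν u₀ 0 w
            (cplx (fun x => α • laplacian u₀ x + ∑ i, (dir i : ℝ) • partialDeriv i u₀ x))}

/-- The tame union of the companion c5: c4's `tameScaling` plus the near-persistent and the intrinsically visible steady
classes. [folklore] -/
def tameUnfold (S : Finset (Fin 3 → ℤ)) (a E ε : ℝ) : Set (Coeff S) :=
  tameScaling S a E ε ∪ persistSteadyNear S a E ε ∪ unfoldSteady S a E ε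

/-! ## §2 Glue (sorry-free): the classes are force-OPEN; the residual over `tameUnfold` proves the crux BY NAME -/

/-- `unfoldSteady ⊆ persistSteadyNear` (the landed `Unfolding.stub_unfoldingPersist`). [folklore] -/
theorem unfoldSteady_subset_persistSteadyNear (S : Finset (Fin 3 → ℤ)) (a E ε : ℝ) :
    unfoldSteady S a E ε ⊆ persistSteadyNear S a E ε := by
  intro c hc
  obtain ⟨ν, hν, hνa, u₀, p₀, hst, hE, hε, v, hv₁, hv₂, hv₃, hker, α, dir, hvis⟩ := hc
  exact ⟨ν, hν, hνa, u₀, p₀, hst, hE, hε,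
    stub_unfoldingPersist S c ν u₀ p₀ v α dir hν hst hv₁ hv₂ hv₃ hker hvis⟩

/-- `persistSteadyNear ⊆ interior LOUD` at the same strict budgets (the landed `SteadyWindowNear.stub_steadyWindowNear`).
[folklore] -/
theorem persistSteadyNear_subset_interior_loud (S : Finset (Fin 3 → ℤ)) (a E ε : ℝ) :
    persistSteadyNear S a E ε ⊆ interior (loud S a E ε) := by
  intro c hc
  obtain ⟨ν, hν, hνa, u₀, p₀, hst, hE, hε, hpers⟩ := hc
  exact SteadyWindowNear.stub_steadyWindowNear S a E ε c ν u₀ p₀ hν hνa hst hE hε hpers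

/-- **(U)** `unfoldSteady ⊆ interior LOUD`: an intrinsically visible simply degenerate steady witness of any mean is an
INTERIOR point of the loud set. [folklore] -/
theorem unfoldSteady_subset_interior_loud (S : Finset (Fin 3 → ℤ)) (a E ε : ℝ) :
    unfoldSteady S a E ε ⊆ interior (loud S a E ε) :=
  (unfoldSteady_subset_persistSteadyNear S a E ε).trans (persistSteadyNear_subset_interior_loud S a E ε)

/-- **The tame union of the companion c5 is force-open up to closure.** [folklore] -/
theorem tameUnfold_subset_closure_interior_loud (S : Finset (Fin 3 → ℤ)) (a E ε : ℝ) :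
    tameUnfold S a E ε ⊆ closure (interior (loud S a E ε)) :=
  Set.union_subset
    (Set.union_subset (ScalingCrossing.tameScaling_subset_closure_interior_loud S a E ε)
      ((persistSteadyNear_subset_interior_loud S a E ε).trans subset_closure))
    ((unfoldSteady_subset_interior_loud S a E ε).trans subset_closure)

/-- **Line glue of the companion c5 (registered sub-goal `line_glue_c5`)**: the residual over `tameUnfold` proves the crux
`RobustLoudUpgrade` BY NAME (`LsCrossing.RobustLoudUpgrade_of_residual`). [folklore] -/
theorem line_glue_c5 : (∀ S : Finset (Fin 3 → ℤ), unitStock ⊆ S → ∀ (a E ε : ℝ), 0 < a → 0 < ε → loud S a E ε ⊆ closure (tameUnfold S a (2 * E) (ε / 2))) → RobustLoudUpgrade :=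
  fun hRes => LsCrossing.RobustLoudUpgrade_of_residual (fun S a E ε => tameUnfold S a E ε)
    tameUnfold_subset_closure_interior_loud hRes

end Unfolding

end Summit.AnomalousDissipation.AnomalousDissipation.Theorems.RobustLoudUpgrade

end

/-! ## §3 Sanity (appended, lead c5 after wave 2): c4's radially visible class R lies in class U

Appended pure-proof section (previous declarations byte-identical).  For a MEAN-ZERO classical steady state the force itself is
first-order visible iff the viscosity generator is: `2 f_c ≡ −νΔu₀ (mod range L(ν,u₀) + ∇)` (landed
`RadialIsUnfolding.stub_radialIsUnfolding`, p131482), so `radialSteady ⊆ unfoldSteady` with the border `(α, dir) = (1, 0)`: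
class U of the companion c5 contains class R of the companion c4 (and, unlike R, asks no mean condition). -/

namespace Summit.AnomalousDissipation.AnomalousDissipation.Theorems.RobustLoudUpgrade.Unfolding

open scoped BigOperators
open Literature.Analysis.FunctionSpaces Literature.Analysis.FunctionSpaces.Torus
open Literature.Analysis.FluidPDE

/-- **Class R ⊆ class U**: a radially visible simply degenerate mean-zero steady witness (c4) is intrinsically visible with the
viscosity border `Δu₀` (`α = 1`, `dir = 0`). [folklore] -/
theorem radialSteady_subset_unfoldSteady : ∀ (S : Finset (Fin 3 → ℤ)) (a E ε : ℝ), radialSteady S a E ε ⊆ unfoldSteady S a E ε := by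
  intro S a E ε c hc
  obtain ⟨ν, hν, hνa, u₀, p₀, hst, h0, hE, hε, v, hv₁, hv₂, hv₃, hker, hvis⟩ := hc
  refine ⟨ν, hν, hνa, u₀, p₀, hst, hE, hε, v, hv₁, hv₂, hv₃, hker, 1, 0, ?_⟩
  have e : (cplx fun x => (1 : ℝ) • laplacian u₀ x + ∑ i, ((0 : Fin 3 → ℤ) i : ℝ) • partialDeriv i u₀ x) =
      cplx (laplacian u₀) := by
    funext x
    simp [cplx]
  rw [e]
  exact RadialIsUnfolding.stub_radialIsUnfolding S c ν u₀ p₀ hν hst h0 hvis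

end Summit.AnomalousDissipation.AnomalousDissipation.Theorems.RobustLoudUpgrade.Unfolding
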